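import Summits.CriticalPhenomena.PercolationContinuityZ3.Theorems.Transplant.CayleyMilnorTransitive
import HarnessLib

/-!
# Milnor's kernel lemma, VIII: PRODUCT ACTIONS — `X □ Y` for two graphs with finite-stabiliser transitive groups `A`, `B` and a rank-2
# homomorphism `A × B → ℤ²`; in particular `b₁(A) ≥ 1` and `b₁(B) ≥ 1` suffice (modulo the one-type scaled node ALONE)

builds on p205010 (kernel theorem, internal audit signed; external expert review pending) — nothing in this file uses p205010.  Every
percolation theorem here is CONDITIONAL on the OPEN node `SamePDropOfSkeletonFrmScaled₁` (hypothesis `hN`; nothing is claimed about it) and on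
NOTHING ELSE.  Lane `prim-bschramm`, seat `prim-bschramm-p4` gen 18 (PART C3 of `P4-GENERAL.md` §40).  Helper file
(`--supports stmt-CriticalPhenomena-4575`).

The chart-free theorem (file IV, `AutScaled.criticalContinuity`) asks for ONE transitive group of automorphisms with finite vertex stabilisers and
first Betti number `≥ 2`.  First Betti numbers ADD under products: if `A` acts on `X` and `B` on `Y` (by automorphisms, transitively, with finite
stabilisers), then `A × B` acts componentwise on `X □ Y` by automorphisms, transitively, with stabiliser `Stab_A × Stab_B` (finite), and any
homomorphism `c : A × B → ℤ²` of rank-2 image closes the argument — in particular `c(a, b) = (χ_A(a), χ_B(b))` for two NONTRIVIAL characters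
`χ_A : A → ℤ`, `χ_B : B → ℤ` (`AutScaled.boxProd_criticalContinuity_of_characters`).  So the rank may be SPLIT between the factors:
**`X □ Y` has `θ_v(p_c) = 0` at every vertex (modulo `U_s`) whenever each factor carries a finite-stabiliser transitive group of automorphisms with
infinite abelianisation** — neither factor need be covered on its own (a factor with `b₁ = 1` is on the multi-type wall of §39.4 (d′)), and
neither need be a Cayley graph (for Cayley factors `Cay(Γ₁) □ Cay(Γ₂) = Cay(Γ₁ × Γ₂)` is already file II's theorem, `b₁(Γ₁ × Γ₂) = b₁(Γ₁) + b₁(Γ₂)`).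
Compare file V (`AutScaled.boxProd_criticalContinuity`): there ALL the rank sits in one factor and the other factor is merely vertex-transitive.
[cite: BenjaminiSchramm1996, Conj. 4; §2 (almost transitive graphs)] [cite: MilnorSolvableGrowth1968, Lemma 1] [cite: Hutchcroft2016, Thm. 1.1]
-/

noncomputable section

namespace Summit.CriticalPhenomena.PercolationContinuityZ3.Theorems.Transplant

open SimpleGraph Literature.Probability.LatticeModels Literature.Probability.Percolation
open scoped Classical

namespace AutScaled

section ProdAction

variable {W V : Type} {A B : Type} [Group A] [Group B] [MulAction A W] [MulAction B V]

/-- **The componentwise action of `A × B` on `W × V`** (a local instance of this file). [folklore] -/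
@[reducible] def prodAction : MulAction (A × B) (W × V) where
  smul ab x := (ab.1 • x.1, ab.2 • x.2)
  one_smul x := Prod.ext (one_smul A x.1) (one_smul B x.2)
  mul_smul a b x := Prod.ext (mul_smul a.1 b.1 x.1) (mul_smul a.2 b.2 x.2)

attribute [local instance] prodAction

/-- The componentwise action, unfolded. [folklore] -/
theorem prod_smul_def (ab : A × B) (x : W × V) : ab • x = (ab.1 • x.1, ab.2 • x.2) := rfl

/-- **`A × B` acts on `X □ Y` by automorphisms** when `A` acts on `X` and `B` on `Y` by automorphisms. [cite: BenjaminiSchramm1996, §2] -/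
theorem isActionByAut_boxProd {X : SimpleGraph W} {Y : SimpleGraph V} (hX : IsActionByAut X A) (hY : IsActionByAut Y B) :
    IsActionByAut (X □ Y) (A × B) := by
  intro ab x y
  rw [prod_smul_def, prod_smul_def, boxProd_adj, boxProd_adj]
  simp only [hX ab.1, hY ab.2, smul_left_cancel_iff]

/-- **The product action is transitive** when both actions are. [folklore] -/
theorem prod_transitive {x₀ : W} {t : V} (hA : ∀ w : W, ∃ a : A, a • x₀ = w) (hB : ∀ v : V, ∃ b : B, b • t = v) (y : W × V) :
    ∃ ab : A × B, ab • (x₀, t) = y := by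
  obtain ⟨a, ha⟩ := hA y.1
  obtain ⟨b, hb⟩ := hB y.2
  exact ⟨(a, b), Prod.ext ha hb⟩

/-- **The stabiliser of `(x₀, t)` is finite** when those of `x₀` and `t` are (it lies in their product). [folklore] -/
theorem stabilizer_prod_finite (x₀ : W) (t : V) (hA : (MulAction.stabilizer A x₀ : Set A).Finite)
    (hB : (MulAction.stabilizer B t : Set B).Finite) : (MulAction.stabilizer (A × B) (x₀, t) : Set (A × B)).Finite := by
  refine (hA.prod hB).subset fun ab hab => ?_
  have h : ab • (x₀, t) = (x₀, t) := hab
  rw [prod_smul_def, Prod.mk.injEq] at h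
  exact ⟨h.1, h.2⟩

/-- **THEOREM (product actions, modulo the scaled node ALONE).**  `X`, `Y` connected locally finite; `A` acts on `X` and `B` on `Y` by
automorphisms, transitively, with finite stabilisers of `x₀`, `t`; `c : A × B → ℤ²` a homomorphism of rank-2 image.  Then `θ_v(p_c(X □ Y)) = 0` at
every vertex. [cite: BenjaminiSchramm1996, Conj. 4; §2] [cite: MilnorSolvableGrowth1968, Lemma 1] [cite: Hutchcroft2016, Thm. 1.1] -/
theorem prodAction_criticalContinuity (hN : SamePDropOfSkeletonFrmScaled₁) (X : SimpleGraph W) [X.LocallyFinite] (Y : SimpleGraph V)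
    [Y.LocallyFinite] (hX : IsActionByAut X A) (hY : IsActionByAut Y B) (hcX : X.Connected) (hcY : Y.Connected) (x₀ : W) (t : V)
    (htrA : ∀ w : W, ∃ a : A, a • x₀ = w) (htrB : ∀ v : V, ∃ b : B, b • t = v) (hfinA : (MulAction.stabilizer A x₀ : Set A).Finite)
    (hfinB : (MulAction.stabilizer B t : Set B).Finite) (c : A × B →* Multiplicative (Site 2))
    (hrank : ∃ p q : A × B, MaxArea.det2 (Multiplicative.toAdd (c p)) (Multiplicative.toAdd (c q)) ≠ 0) (v : W × V) :
    theta (X □ Y) v (criticalProbIOf (X □ Y) v) = 0 :=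
  AutScaled.criticalContinuity hN (isActionByAut_boxProd hX hY) (hcX.boxProd hcY) (x₀, t) (prod_transitive htrA htrB)
    (stabilizer_prod_finite x₀ t hfinA hfinB) c hrank v

/-! ### Splitting the rank: one nontrivial character on each factor -/

/-- A character `χ : A → ℤ` placed in coordinate `i` of `ℤ²`. [folklore] -/
def coordChar (χ : A →* Multiplicative ℤ) (i : Fin 2) : A →* Multiplicative (Site 2) :=
  (AddMonoidHom.toMultiplicative (AddMonoidHom.single (fun _ : Fin 2 => ℤ) i)).comp χ

/-- Value of `coordChar`. [folklore] -/
theorem toAdd_coordChar (χ : A →* Multiplicative ℤ) (i : Fin 2) (a : A) :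
    (coordChar χ i a).toAdd = Pi.single i (χ a).toAdd := rfl

/-- **The pair character** `(a, b) ↦ (χ_A(a), χ_B(b))`. [folklore] -/
def pairChar (χA : A →* Multiplicative ℤ) (χB : B →* Multiplicative ℤ) : A × B →* Multiplicative (Site 2) :=
  ((coordChar χA 0).comp (MonoidHom.fst A B)) * ((coordChar χB 1).comp (MonoidHom.snd A B))

/-- Value of the pair character. [folklore] -/
theorem toAdd_pairChar (χA : A →* Multiplicative ℤ) (χB : B →* Multiplicative ℤ) (a : A) (b : B) :
    (pairChar χA χB (a, b)).toAdd = ![(χA a).toAdd, (χB b).toAdd] := by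
  show ((coordChar χA 0 a) * (coordChar χB 1 b)).toAdd = _
  rw [toAdd_mul, toAdd_coordChar, toAdd_coordChar]
  ext i; fin_cases i <;> simp

/-- **Two nontrivial characters give a rank-2 pair character**: `det((χ_A a₀, 0), (0, χ_B b₀)) = χ_A(a₀) χ_B(b₀) ≠ 0`. [folklore] -/
theorem pairChar_rank (χA : A →* Multiplicative ℤ) (χB : B →* Multiplicative ℤ) (a₀ : A) (ha : χA a₀ ≠ 1) (b₀ : B) (hb : χB b₀ ≠ 1) :
    ∃ p q : A × B, MaxArea.det2 (pairChar χA χB p).toAdd (pairChar χA χB q).toAdd ≠ 0 := by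
  refine ⟨(a₀, 1), (1, b₀), ?_⟩
  rw [toAdd_pairChar, toAdd_pairChar, χA.map_one, χB.map_one, toAdd_one, MaxArea.det2]
  have ha' : (χA a₀).toAdd ≠ 0 := fun h => ha (by rw [← ofAdd_toAdd (χA a₀), h]; rfl)
  have hb' : (χB b₀).toAdd ≠ 0 := fun h => hb (by rw [← ofAdd_toAdd (χB b₀), h]; rfl)
  simpa using And.intro ha' hb'

/-- **THEOREM (split rank, modulo the scaled node ALONE): `θ_v(p_c(X □ Y)) = 0` at every vertex whenever EACH factor carries a transitive group of
automorphisms with finite stabilisers and a NONTRIVIAL character to `ℤ`** (infinite abelianisation, `b₁ ≥ 1`).  Neither factor need be covered on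
its own. [cite: BenjaminiSchramm1996, Conj. 4; §2] [cite: MilnorSolvableGrowth1968, Lemma 1] [cite: Hutchcroft2016, Thm. 1.1] -/
theorem boxProd_criticalContinuity_of_characters (hN : SamePDropOfSkeletonFrmScaled₁) (X : SimpleGraph W) [X.LocallyFinite]
    (Y : SimpleGraph V) [Y.LocallyFinite] (hX : IsActionByAut X A) (hY : IsActionByAut Y B) (hcX : X.Connected) (hcY : Y.Connected)
    (x₀ : W) (t : V) (htrA : ∀ w : W, ∃ a : A, a • x₀ = w) (htrB : ∀ v : V, ∃ b : B, b • t = v)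
    (hfinA : (MulAction.stabilizer A x₀ : Set A).Finite) (hfinB : (MulAction.stabilizer B t : Set B).Finite)
    (χA : A →* Multiplicative ℤ) (a₀ : A) (ha : χA a₀ ≠ 1) (χB : B →* Multiplicative ℤ) (b₀ : B) (hb : χB b₀ ≠ 1) (v : W × V) :
    theta (X □ Y) v (criticalProbIOf (X □ Y) v) = 0 :=
  prodAction_criticalContinuity hN X Y hX hY hcX hcY x₀ t htrA htrB hfinA hfinB (pairChar χA χB) (pairChar_rank χA χB a₀ ha b₀ hb) v

/-- … and `θ_v(p) = 0` on `X □ Y` for every `p ≤ p_c`. [cite: BenjaminiSchramm1996, Conj. 4; §2] -/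
theorem boxProd_theta_eq_zero_of_le_of_characters (hN : SamePDropOfSkeletonFrmScaled₁) (X : SimpleGraph W) [X.LocallyFinite]
    (Y : SimpleGraph V) [Y.LocallyFinite] (hX : IsActionByAut X A) (hY : IsActionByAut Y B) (hcX : X.Connected) (hcY : Y.Connected)
    (x₀ : W) (t : V) (htrA : ∀ w : W, ∃ a : A, a • x₀ = w) (htrB : ∀ v : V, ∃ b : B, b • t = v)
    (hfinA : (MulAction.stabilizer A x₀ : Set A).Finite) (hfinB : (MulAction.stabilizer B t : Set B).Finite)
    (χA : A →* Multiplicative ℤ) (a₀ : A) (ha : χA a₀ ≠ 1) (χB : B →* Multiplicative ℤ) (b₀ : B) (hb : χB b₀ ≠ 1) (v : W × V)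
    {p : unitInterval} (hp : (p : ℝ) ≤ criticalProb (X □ Y) v) : theta (X □ Y) v p = 0 :=
  AutScaled.theta_eq_zero_of_le hN (isActionByAut_boxProd hX hY) (hcX.boxProd hcY) (x₀, t) (prod_transitive htrA htrB)
    (stabilizer_prod_finite x₀ t hfinA hfinB) (pairChar χA χB) (pairChar_rank χA χB a₀ ha b₀ hb) v hp

end ProdAction

/-! ### The Cayley form: `Cay(Γ; S) □ Y` with one nontrivial character on `Γ` and one on `Y`'s group -/

section CayleyFactor

variable {V : Type} {B : Type} [Group B] [MulAction B V] {Γ : Type} [Group Γ]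

/-- Left multiplication is an action of `Γ` on `Cay(Γ; S)` by automorphisms. [cite: BenjaminiSchramm1996, §2 (Cayley graphs)] -/
theorem isActionByAut_mulCayley (S : Set Γ) : IsActionByAut (mulCayley S) Γ := fun _ _ _ => mulCayley_adj_mul_iff_right

/-- Left multiplication is free: the stabiliser of `1` is finite (trivial). [folklore] -/
theorem stabilizer_one_finite : (MulAction.stabilizer Γ (1 : Γ) : Set Γ).Finite := by
  refine (Set.finite_singleton (1 : Γ)).subset fun g hg => ?_
  have h : g • (1 : Γ) = 1 := hg
  rwa [smul_eq_mul, mul_one] at h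

attribute [local instance] prodAction in
/-- **`Cay(Γ; S) □ Y` (modulo the scaled node ALONE)** for a finitely generated `Γ` with a nontrivial character `Γ → ℤ` (`b₁(Γ) ≥ 1`) and a connected
locally finite `Y` with a finite-stabiliser transitive group of automorphisms carrying a nontrivial character: `θ_v(p_c) = 0` at every vertex.
(With `b₁(Γ) ≥ 2` alone, or with `Y`'s group of rank 2 alone, files II and V apply; here the rank is split.)
[cite: BenjaminiSchramm1996, Conj. 4; §2] [cite: MilnorSolvableGrowth1968, Lemma 1] [cite: Hutchcroft2016, Thm. 1.1] -/
theorem mulCayley_boxProd_criticalContinuity_of_characters (hN : SamePDropOfSkeletonFrmScaled₁) (S : Finset Γ)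
    (hS : Subgroup.closure (S : Set Γ) = ⊤) (χΓ : Γ →* Multiplicative ℤ) (g₀ : Γ) (hg : χΓ g₀ ≠ 1) (Y : SimpleGraph V) [Y.LocallyFinite]
    (hY : IsActionByAut Y B) (hcY : Y.Connected) (t : V) (htrB : ∀ v : V, ∃ b : B, b • t = v)
    (hfinB : (MulAction.stabilizer B t : Set B).Finite) (χB : B →* Multiplicative ℤ) (b₀ : B) (hb : χB b₀ ≠ 1) (v : Γ × V) :
    theta (mulCayley (S : Set Γ) □ Y) v (criticalProbIOf (mulCayley (S : Set Γ) □ Y) v) = 0 :=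
  boxProd_criticalContinuity_of_characters hN (mulCayley (S : Set Γ)) Y (isActionByAut_mulCayley (S : Set Γ)) hY
    (CayleyScaled.connected_mulCayley_of_closure S hS) hcY 1 t (fun w => ⟨w, mul_one w⟩) htrB stabilizer_one_finite hfinB χΓ g₀ hg
    χB b₀ hb v

end CayleyFactor

end AutScaled

end Summit.CriticalPhenomena.PercolationContinuityZ3.Theorems.Transplant

end
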